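import Literature.NumberTheory.ConnesMoscovici2022.UVProlateBoundaryFunctional
import Literature.NumberTheory.ConnesMoscovici2022.UVProlateDeficiencyIndices
import Literature.NumberTheory.ConnesMoscovici2022.UVProlateQuotientBasis
import Literature.NumberTheory.ConnesMoscovici2022.UVProlateSADomain
import Literature.Analysis.UnboundedOperators.SelfAdjointExtensions
import HarnessLib

/-!
# Connes–Moscovici 2022 §1: von Neumann's formula for the prolate wave operator, `dim ℰ = 8`, and
# Lemma 1.5 (corrected) reduced to the `Ω`-matrix of the eight printed vectors

LINE 1 — FRAMING. RH-FREE corpus literature (abstract spectral theory of the prolate wave operator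
`W_λ = −∂ₓ(λ² − x²)∂ₓ + (2πλx)²` on `L²(ℝ)`; cell rh-crit C1, sequel row O2 `UVProlateSpectrum`, no
leaf / binder role).  bears_on: LADDER-RH W-C/W-P only.  WHAT THIS IS NOT: any claim about `ζ` or RH;
nothing in this file mentions `RiemannHypothesis` or bears on the truth of RH.  Theorems only (0 defs,
0 named facts); `CM22_lemma_1_5_corr` and `CM22_thm_1_6` stay named facts.

Source: A. Connes, H. Moscovici, *The UV prolate spectrum matches the zeros of zeta*, PNAS 119 (2022)
[bib: `ConnesMoscovici2022`] = arXiv:2112.05500, §1 (= arXiv §2): Lemma 1.1 (deficiency indices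
`(4,4)`; tree `CM22_lemma_1_1_holds` / `finrank_eigenspace_prolateMax`), the paragraph after Lemma 1.3
(arXiv p. 4, eq. (2.4) = (1.4)): «The selfadjoint extensions of `W_min` are parametrized by
self-orthogonal subspaces of `ℰ := Dom(W_max)/Dom(W_min)` with respect to the anti-symmetric
sesquilinear form given by the pairing `Ω(ξ, η) := (1/i)(⟨W_max ξ | η⟩ − ⟨ξ | W_max η⟩)` … which
descends to a non-degenerate form on `ℰ`», and Lemma 1.5 (= arXiv Lemma 2.5, chunk p0005:L84–L104):
«The quadruplet `{α±, β±, α̂±, β̂±}` forms a basis of `ℰ±`.  *Proof.* One checks using the expression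
(1.7) of the `Ω`-pairing together with Lemma 1.4 that the matrix representation of `Ω₊` with respect
to the given quadruplet has a single nonzero entry in each row and column …».  The abstract input is
von Neumann's first formula [EdmundsEvans2018, Ch. III §4 Thm 4.5, (4.6)–(4.7)] (tree
`Literature.Analysis.UnboundedOperators.VonNeumannDecomposition` / `SelfAdjointExtensions`).

## What is proved (the tree's abstract von Neumann theory instantiated at `T = prolateCore λ`,
## `W_min = T.closure`, `W_max = T†`; the tree's `omegaForm` for `Ω`)

* `isClosed_prolateMin`, `prolateMin_isSymmetric`, `dense_prolateMin_domain`,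
  **`adjoint_prolateMin : (prolateMin λ)† = prolateMax λ`** (`W_max = W_min*`), and the vanishing of
  the boundary form on `dom W_min`: `inner_prolateMax_comm_of_mem_prolateMin_left/right`,
  `omegaForm_eq_zero_of_mem_prolateMin_left/right`;
* **von Neumann's formula** `prolateMax_domain_eq_sup : dom W_max = dom W_min ⊔ 𝒩₊ ⊔ 𝒩₋`
  (`𝒩± = ker(W_max ∓ i) = (prolateMax λ).eigenspace (±I)`), `exists_prolate_decomposition`,
  `prolate_decomposition_unique`, `nonempty_prolateDeficiency_prod_equiv_quotient`
  (`𝒩₊ × 𝒩₋ ≃ₗ dom W_max / dom W_min`), `finrank_prolateMax_quotient` (`= m₊ + m₋`);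
* **`dim ℰ = 8` unconditionally** (`finrank_prolateMax_quotient_eq_eight`, `0 < λ`; `= 4 + 4` by the
  tree's `finrank_eigenspace_prolateMax`), `finiteDimensional_prolateMax_quotient`,
  `finiteDimensional_eigenspace_prolateMax`;
* the **basis criterion** `existsUnique_coeffs_of_independent_mod`: eight vectors of `dom W_max`
  linearly independent modulo `dom W_min` represent every `ξ ∈ dom W_max` uniquely modulo `dom W_min`
  (`le_eight_of_independent_mod`: never more than eight; `independent_mod_of_existsUnique_coeffs`:
  the converse);
* the **`Ω`-matrix criterion** (mechanism of the printed proof): `omegaForm_add_right`,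
  `omegaForm_smul_right`, `omegaForm_swap` (`Ω` is Hermitian), `omegaForm_sum_smul_right`,
  **`independent_mod_of_omegaMatrix`** / `independent_mod_of_det_omegaMatrix_ne_zero` (trivial kernel /
  non-zero determinant of `(Ω(vⱼ, vᵢ))ⱼᵢ` ⟹ independence modulo `dom W_min`),
  `existsUnique_coeffs_of_omegaMatrix`;
* the reductions **`CM22_lemma_1_5_corr_of_independent`** and **`CM22_lemma_1_5_corr_of_omegaMatrix`**:
  the corrected Lemma 1.5 (`UVProlateQuotientBasis.lean`) follows from the membership of the eight
  printed vectors in `dom W_max` together with EITHER their independence modulo `dom W_min` OR the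
  triviality of the kernel of their `8 × 8` `Ω`-matrix — spanning is automatic by `dim ℰ = 8`.  NOT
  proved here: that membership and that matrix (the concrete half of the printed proof);
* (second pass) the rectangular criterion `independent_mod_of_omegaMatrix₂` (candidates `uᵢ` tested
  against `vⱼ`), and the **doors to Thm 1.6 (i)/(iii)** through the tree's abstract
  `isSelfAdjoint_of_isSymmetric_of_independent` / `eq_of_isSelfAdjoint_of_le`
  (`SelfAdjointExtensions.lean`, [EdmundsEvans2018, III Thm 4.8, (4.11)]):
  `le_prolateMax_of_prolateMin_le_of_isSymmetric/IsSelfAdjoint` (extensions of `W_min` live in `ℰ`),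
  **`isSelfAdjoint_of_prolateMin_le_of_independent`** (a symmetric `S ⊇ W_min` containing four vectors
  independent modulo `dom W_min` is self-adjoint) / `…_of_omegaMatrix`, `prolateMin_le_prolateSA`,
  `prolateSA_isSymmetric_of`, **`isSelfAdjoint_prolateSA_of_independent`** (self-adjointness of `W_sa`
  ⇐ `dom W_min ⊆ 𝓛_β` + symmetry on `𝓛_β` + four independent vectors `β±, β̂± ∈ 𝓛_β`), and
  maximality **`eq_of_isSelfAdjoint_of_prolateMin_le_of_domain_le`** /
  `IsProlateSA.eq_of_isSelfAdjoint_of_subset` (Thm 1.6 (iii) modulo «commuting with `P_λ, P̂_λ` forces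
  `𝓛_β ⊆ dom W'`»);
* (third pass) the structure of symmetric extensions with four independent vectors
  ([EdmundsEvans2018, III Thm 4.8 (4.10)–(4.11)] via the tree's `existsUnique_coeffs_of_isSymmetric`):
  `le_four_of_prolateMin_le_of_independent`, **`existsUnique_coeffs_of_prolateMin_le_of_independent`**,
  `domain_eq_sup_span_of_prolateMin_le_of_independent` (`dom S = dom W_min ∔ span{u₁,…,u₄}`), and
  **`prolateSADomain_eq_sup_span_of_independent`** — the first sentence of the printed proof of
  Thm 1.6 (ii), «every element of `𝓛_β` is a linear combination of an element of `Dom W_min` and the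
  4 vectors `β±, β̂±`», granted `dom W_min ⊆ 𝓛_β`, symmetry on `𝓛_β` and the independence of the four
  vectors;
* (fourth pass) **the Lagrangian door** «`W_sa` is selfadjoint by construction»:
  **`isSelfAdjoint_domRestrict_of_omega_annihilator`** — for four pairwise `Ω`-orthogonal vectors
  `bₖ ∈ dom W_max` independent modulo `dom W_min`, the restriction of `W_max` to their `Ω`-annihilator
  `L` is self-adjoint and `L = dom W_min ∔ span{bₖ}` (isotropy of `U = dom W_min + span{bₖ}` ⟹
  `W_max|_U` self-adjoint by the dimension count ⟹ `L ⊆ dom (W_max|_U)† = U ⊆ L`); specialised: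
  **`isSelfAdjoint_prolateSA_of_omega_annihilator`** / `IsProlateSA.isSelfAdjoint_of_omega_annihilator`
  — Thm 1.6 (i) self-adjointness ⇐ the identification (1.15) of `𝓛_β` as the `Ω`-annihilator of
  `β±, β̂±` + their pairwise `Ω`-orthogonality + independence modulo `dom W_min`.
  `CM22_thm_1_6` stays a named fact.

Nothing in this file bears on the truth of RH.
-/

noncomputable section

open Complex Set MeasureTheory Filter
open scoped InnerProductSpace ComplexConjugate
open _root_.LinearPMap Literature.Analysis.UnboundedOperators

namespace Literature.NumberTheory.ConnesMoscovici2022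

/-! ### The core `W|_𝒮` is symmetric, densely defined and closable; `W_max = W_min†` -/

/-- `W` on the Schwartz core is a symmetric `LinearPMap` (tree `prolateCore_symmetric`). [cite: ConnesMoscovici2022, §1 ¶1, `W_min`/`W_max` as closure/adjoint of `W|_𝒮` (= arXiv:2112.05500 §2, chunk p0004:L15–L20); EdmundsEvans2018, Ch. III §4 ¶1] -/
theorem prolateCore_isSymmetric (lam : ℝ) : (prolateCore lam).IsSymmetric := prolateCore_symmetric lam

/-- The core `𝒮(ℝ) ⊂ L²(ℝ)` is dense. [cite: ConnesMoscovici2022, §1 ¶1, `W_min`/`W_max` as closure/adjoint of `W|_𝒮` (= arXiv:2112.05500 §2, chunk p0004:L15–L20); EdmundsEvans2018, Ch. III §4 ¶1] -/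
theorem dense_prolateCore_domain (lam : ℝ) : Dense ((prolateCore lam).domain : Set L2R) :=
  dense_schwartzL2

/-- The core is closable (it sits below the closed operator `W_max = (W|_𝒮)†`). [cite: ConnesMoscovici2022, §1 ¶1, `W_min`/`W_max` as closure/adjoint of `W|_𝒮` (= arXiv:2112.05500 §2, chunk p0004:L15–L20); EdmundsEvans2018, Ch. III §4 ¶1] -/
theorem isClosable_prolateCore (lam : ℝ) : (prolateCore lam).IsClosable :=
  isClosable_of_isSymmetric (prolateCore_isSymmetric lam) (dense_prolateCore_domain lam)

/-- `W_min` is closed. [cite: ConnesMoscovici2022, §1 ¶1, `W_min`/`W_max` as closure/adjoint of `W|_𝒮` (= arXiv:2112.05500 §2, chunk p0004:L15–L20); EdmundsEvans2018, Ch. III §4 ¶1] -/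
theorem isClosed_prolateMin (lam : ℝ) : (prolateMin lam).IsClosed :=
  (isClosable_prolateCore lam).closure_isClosed

/-- `W_min` is symmetric. [cite: ConnesMoscovici2022, §1 ¶1, `W_min`/`W_max` as closure/adjoint of `W|_𝒮` (= arXiv:2112.05500 §2, chunk p0004:L15–L20); EdmundsEvans2018, Ch. III §4 ¶1] -/
theorem prolateMin_isSymmetric (lam : ℝ) : (prolateMin lam).IsSymmetric :=
  isSymmetric_closure (prolateCore_isSymmetric lam) (dense_prolateCore_domain lam)

/-- `dom W_min` is dense. [cite: ConnesMoscovici2022, §1 ¶1, `W_min`/`W_max` as closure/adjoint of `W|_𝒮` (= arXiv:2112.05500 §2, chunk p0004:L15–L20); EdmundsEvans2018, Ch. III §4 ¶1] -/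
theorem dense_prolateMin_domain (lam : ℝ) : Dense ((prolateMin lam).domain : Set L2R) :=
  (dense_prolateCore_domain lam).mono fun _ hx => (prolateCore lam).le_closure.1 hx

/-- **`W_max = W_min†`**: the adjoint of the closure is the adjoint of the core. [cite: ConnesMoscovici2022, §1 ¶1, `W_min`/`W_max` as closure/adjoint of `W|_𝒮` (= arXiv:2112.05500 §2, chunk p0004:L15–L20); EdmundsEvans2018, Ch. III §4 ¶1] -/
theorem adjoint_prolateMin (lam : ℝ) : (prolateMin lam)† = prolateMax lam :=
  adjoint_closure (dense_prolateCore_domain lam) (isClosable_prolateCore lam)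

/-- `⟪W_max ξ, η⟫ = ⟪ξ, W_max η⟫` as soon as `η ∈ dom W_min` (the boundary form of `W_max` dies on
`dom W_min`). [cite: ConnesMoscovici2022, §1 eq. (1.4) and the sentence around it, «Ω … descends to a non-degenerate form on ℰ» (= arXiv:2112.05500 eq. (2.4), arXiv p. 4)] -/
theorem inner_prolateMax_comm_of_mem_prolateMin_right {lam : ℝ} (ξ η : (prolateMax lam).domain)
    (hη : (η : L2R) ∈ (prolateMin lam).domain) :
    ⟪(prolateMax lam ξ : L2R), (η : L2R)⟫_ℂ = ⟪(ξ : L2R), (prolateMax lam η : L2R)⟫_ℂ := by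
  have hξ' : (ξ : L2R) ∈ ((prolateMin lam)†).domain := by rw [adjoint_prolateMin]; exact ξ.2
  have hη' : (η : L2R) ∈ ((prolateMin lam)†).domain := by rw [adjoint_prolateMin]; exact η.2
  have h := inner_adjoint_sub_eq_zero_right (prolateMin_isSymmetric lam) (dense_prolateMin_domain lam)
    ⟨ξ, hξ'⟩ ⟨η, hη'⟩ hη
  have e1 : ((prolateMin lam)† ⟨ξ, hξ'⟩ : L2R) = prolateMax lam ξ := (adjoint_prolateMin lam).le.2 rfl
  have e2 : ((prolateMin lam)† ⟨η, hη'⟩ : L2R) = prolateMax lam η := (adjoint_prolateMin lam).le.2 rfl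
  rw [e1, e2] at h
  exact sub_eq_zero.1 h

/-- `⟪W_max ξ, η⟫ = ⟪ξ, W_max η⟫` as soon as `ξ ∈ dom W_min`. [cite: ConnesMoscovici2022, §1 eq. (1.4) and the sentence around it, «Ω … descends to a non-degenerate form on ℰ» (= arXiv:2112.05500 eq. (2.4), arXiv p. 4)] -/
theorem inner_prolateMax_comm_of_mem_prolateMin_left {lam : ℝ} (ξ η : (prolateMax lam).domain)
    (hξ : (ξ : L2R) ∈ (prolateMin lam).domain) :
    ⟪(prolateMax lam ξ : L2R), (η : L2R)⟫_ℂ = ⟪(ξ : L2R), (prolateMax lam η : L2R)⟫_ℂ := by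
  rw [← inner_conj_symm, ← inner_prolateMax_comm_of_mem_prolateMin_right η ξ hξ, inner_conj_symm]

/-! ### Von Neumann's formula `dom W_max = dom W_min ∔ 𝒩₊ ∔ 𝒩₋` and `dim (dom W_max / dom W_min) = 8` -/

/-- **`dom W_max = dom W_min + ker(W_max − i) + ker(W_max + i)`** (von Neumann's first formula for the
prolate operator). [cite: EdmundsEvans2018, Ch. III §4 Thm 4.5 (4.6)–(4.7); ConnesMoscovici2022, §1 Lemma 1.1 and the `ℰ`-paragraph after Lemma 1.3 (= arXiv:2112.05500 Lemma 2.1, arXiv p. 4)] -/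
theorem prolateMax_domain_eq_sup (lam : ℝ) :
    (prolateMax lam).domain =
      (prolateMin lam).domain ⊔ (prolateMax lam).eigenspace I ⊔ (prolateMax lam).eigenspace (-I) :=
  adjoint_domain_eq_closure_domain_sup (prolateCore_isSymmetric lam) (dense_prolateCore_domain lam)

/-- existence of the decomposition `ξ = ξ₀ + ξ₊ + ξ₋` [cite: EdmundsEvans2018, Ch. III §4 Thm 4.5 (4.6)–(4.7); ConnesMoscovici2022, §1 Lemma 1.1 and the `ℰ`-paragraph after Lemma 1.3 (= arXiv:2112.05500 Lemma 2.1, arXiv p. 4)] -/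
theorem exists_prolate_decomposition (lam : ℝ) {ξ : L2R} (hξ : ξ ∈ (prolateMax lam).domain) :
    ∃ ξ₀ ∈ (prolateMin lam).domain, ∃ ξp ∈ (prolateMax lam).eigenspace I,
      ∃ ξm ∈ (prolateMax lam).eigenspace (-I), ξ = ξ₀ + ξp + ξm := by
  have h := exists_vonNeumann_decomposition (prolateMin_isSymmetric lam) (isClosed_prolateMin lam)
    (dense_prolateMin_domain lam) (x := ξ) (by rw [adjoint_prolateMin]; exact hξ)
  rwa [adjoint_prolateMin] at h

/-- the decomposition is direct [cite: EdmundsEvans2018, Ch. III §4 Thm 4.5 (4.6)–(4.7); ConnesMoscovici2022, §1 Lemma 1.1 and the `ℰ`-paragraph after Lemma 1.3 (= arXiv:2112.05500 Lemma 2.1, arXiv p. 4)] -/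
theorem prolate_decomposition_unique (lam : ℝ) {ξ₀ ξp ξm : L2R} (h₀ : ξ₀ ∈ (prolateMin lam).domain)
    (hp : ξp ∈ (prolateMax lam).eigenspace I) (hm : ξm ∈ (prolateMax lam).eigenspace (-I))
    (h : ξ₀ + ξp + ξm = 0) : ξ₀ = 0 ∧ ξp = 0 ∧ ξm = 0 :=
  vonNeumann_decomposition_unique_closure (prolateCore_isSymmetric lam) (dense_prolateCore_domain lam)
    h₀ hp hm h

/-- `𝒩₊ × 𝒩₋ ≃ dom W_max / dom W_min`, linearly (`(ξ₊, ξ₋) ↦ [ξ₊ + ξ₋]`). [cite: EdmundsEvans2018, Ch. III §4 Thm 4.5 (4.6)–(4.7); ConnesMoscovici2022, §1 Lemma 1.1 and the `ℰ`-paragraph after Lemma 1.3 (= arXiv:2112.05500 Lemma 2.1, arXiv p. 4)] -/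
theorem nonempty_prolateDeficiency_prod_equiv_quotient (lam : ℝ) :
    Nonempty ((↥((prolateMax lam).eigenspace I) × ↥((prolateMax lam).eigenspace (-I))) ≃ₗ[ℂ]
      (↥((prolateMax lam).domain) ⧸ ((prolateMin lam).domain.comap (prolateMax lam).domain.subtype))) := by
  have h := nonempty_deficiency_prod_equiv_quotient (prolateMin_isSymmetric lam) (isClosed_prolateMin lam)
    (dense_prolateMin_domain lam)
  rwa [adjoint_prolateMin] at h

/-- **`dim (dom W_max / dom W_min) = m₊ + m₋`** whenever the deficiency spaces are finite-dimensional
(no positivity assumption on `λ`). [cite: EdmundsEvans2018, Ch. III §4 Thm 4.5 (4.6)–(4.7); ConnesMoscovici2022, §1 Lemma 1.1 and the `ℰ`-paragraph after Lemma 1.3 (= arXiv:2112.05500 Lemma 2.1, arXiv p. 4)] -/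
theorem finrank_prolateMax_quotient (lam : ℝ)
    [FiniteDimensional ℂ ((prolateMax lam).eigenspace I)] [FiniteDimensional ℂ ((prolateMax lam).eigenspace (-I))] :
    Module.finrank ℂ (↥((prolateMax lam).domain) ⧸ ((prolateMin lam).domain.comap (prolateMax lam).domain.subtype)) =
      Module.finrank ℂ ((prolateMax lam).eigenspace I) + Module.finrank ℂ ((prolateMax lam).eigenspace (-I)) := by
  obtain ⟨e⟩ := nonempty_prolateDeficiency_prod_equiv_quotient lam
  rw [← e.finrank_eq, Module.finrank_prod]

/-- the deficiency spaces `ker(W_max − z)` are finite-dimensional (`dim = 4`, tree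
`finrank_eigenspace_prolateMax`). [cite: ConnesMoscovici2022, Lemma 1.1 (= arXiv:2112.05500 Lemma 2.1, chunk p0004:L39–L48); EdmundsEvans2018, Ch. III §4 Thm 4.5 (4.7)] -/
theorem finiteDimensional_eigenspace_prolateMax {lam : ℝ} (hlam : 0 < lam) (z : ℂ) :
    FiniteDimensional ℂ ((prolateMax lam).eigenspace z) :=
  Module.finite_of_finrank_eq_succ (finrank_eigenspace_prolateMax hlam z)

/-- **`dim (dom W_max / dom W_min) = 8`**, unconditionally (`= 4 + 4` by Lemma 1.1, tree
`CM22_lemma_1_1_holds` / `finrank_eigenspace_prolateMax`). [cite: ConnesMoscovici2022, Lemma 1.1 (= arXiv:2112.05500 Lemma 2.1, chunk p0004:L39–L48); EdmundsEvans2018, Ch. III §4 Thm 4.5 (4.7)] -/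
theorem finrank_prolateMax_quotient_eq_eight {lam : ℝ} (hlam : 0 < lam) :
    Module.finrank ℂ (↥((prolateMax lam).domain) ⧸ ((prolateMin lam).domain.comap (prolateMax lam).domain.subtype)) = 8 := by
  haveI := finiteDimensional_eigenspace_prolateMax hlam I
  haveI := finiteDimensional_eigenspace_prolateMax hlam (-I)
  rw [finrank_prolateMax_quotient lam, finrank_eigenspace_prolateMax hlam I,
    finrank_eigenspace_prolateMax hlam (-I)]

/-- `dom W_max / dom W_min` is finite-dimensional. [cite: ConnesMoscovici2022, Lemma 1.1 (= arXiv:2112.05500 Lemma 2.1, chunk p0004:L39–L48); EdmundsEvans2018, Ch. III §4 Thm 4.5 (4.7)] -/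
theorem finiteDimensional_prolateMax_quotient {lam : ℝ} (hlam : 0 < lam) :
    FiniteDimensional ℂ (↥((prolateMax lam).domain) ⧸ ((prolateMin lam).domain.comap (prolateMax lam).domain.subtype)) :=
  Module.finite_of_finrank_eq_succ (finrank_prolateMax_quotient_eq_eight hlam)

/-! ### Bases of `dom W_max / dom W_min`: independence modulo `dom W_min` -/

/-- **Abstract basis step**: if `dim (dom W_max / dom W_min) = n` and `v : Fin n → dom W_max` is
linearly independent modulo `dom W_min`, then every `ξ ∈ dom W_max` differs from a UNIQUE combination
`∑ cᵢ vᵢ` by an element of `dom W_min`. [cite: ConnesMoscovici2022, Lemma 1.5 and its proof (= arXiv:2112.05500 Lemma 2.5, chunk p0005:L84–L104)] -/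
theorem existsUnique_coeffs_of_independent_mod_of_finrank_eq {lam : ℝ} {n : ℕ}
    (hdim : Module.finrank ℂ (↥((prolateMax lam).domain) ⧸
      ((prolateMin lam).domain.comap (prolateMax lam).domain.subtype)) = n)
    (hfin : FiniteDimensional ℂ (↥((prolateMax lam).domain) ⧸
      ((prolateMin lam).domain.comap (prolateMax lam).domain.subtype)))
    (v : Fin n → L2R) (hv : ∀ i, v i ∈ (prolateMax lam).domain)
    (hind : ∀ c : Fin n → ℂ, (∑ i, c i • v i) ∈ (prolateMin lam).domain → c = 0)
    {ξ : L2R} (hξ : ξ ∈ (prolateMax lam).domain) :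
    ∃! c : Fin n → ℂ, ξ - ∑ i, c i • v i ∈ (prolateMin lam).domain := by
  set Dq : Submodule ℂ ↥((prolateMax lam).domain) :=
    (prolateMin lam).domain.comap (prolateMax lam).domain.subtype with hDq
  haveI := hfin
  -- `Φ c = [∑ cᵢ vᵢ]`
  set w : Fin n → ↥((prolateMax lam).domain) := fun i => ⟨v i, hv i⟩ with hw
  set Φ : (Fin n → ℂ) →ₗ[ℂ] (↥((prolateMax lam).domain) ⧸ Dq) :=
    Dq.mkQ.comp (Fintype.linearCombination ℂ w) with hΦ
  have hΦ_apply : ∀ c : Fin n → ℂ, Φ c = Dq.mkQ (∑ i, c i • w i) := by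
    intro c; simp [hΦ, Fintype.linearCombination_apply]
  have hsum : ∀ c : Fin n → ℂ, (((∑ i, c i • w i : ↥((prolateMax lam).domain))) : L2R) = ∑ i, c i • v i := by
    intro c; simp [hw]
  have hinj : Function.Injective Φ := by
    rw [← LinearMap.ker_eq_bot, LinearMap.ker_eq_bot']
    intro c hc
    rw [hΦ_apply, Submodule.mkQ_apply, Submodule.Quotient.mk_eq_zero, hDq, Submodule.mem_comap,
      Submodule.subtype_apply, hsum] at hc
    exact hind c hc
  have hsurj : Function.Surjective Φ := by
    have hfr : Module.finrank ℂ (Fin n → ℂ) = Module.finrank ℂ (↥((prolateMax lam).domain) ⧸ Dq) := by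
      rw [Module.finrank_fin_fun, hdim]
    exact (LinearMap.injective_iff_surjective_of_finrank_eq_finrank hfr).1 hinj
  obtain ⟨c, hc⟩ := hsurj (Dq.mkQ ⟨ξ, hξ⟩)
  refine ⟨c, ?_, fun c' hc' => ?_⟩
  · show ξ - ∑ i, c i • v i ∈ (prolateMin lam).domain
    rw [hΦ_apply, Submodule.mkQ_apply, Submodule.mkQ_apply, Submodule.Quotient.eq, hDq,
      Submodule.mem_comap, _root_.map_sub, Submodule.subtype_apply, Submodule.subtype_apply, hsum] at hc
    have h' := Submodule.neg_mem _ hc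
    rwa [neg_sub] at h'
  · apply hinj
    rw [hc, hΦ_apply, Submodule.mkQ_apply, Submodule.mkQ_apply, Submodule.Quotient.eq, hDq,
      Submodule.mem_comap, _root_.map_sub, Submodule.subtype_apply, Submodule.subtype_apply, hsum]
    have hc'' : ξ - ∑ i, c' i • v i ∈ (prolateMin lam).domain := hc'
    have h' := Submodule.neg_mem _ hc''
    rwa [neg_sub] at h'

/-- **Eight vectors of `dom W_max` independent modulo `dom W_min` form a basis of
`dom W_max / dom W_min`** (`dim = 8`): every `ξ ∈ dom W_max` is `≡ ∑ cᵢ vᵢ (mod dom W_min)` for a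
unique `c ∈ ℂ⁸`. [cite: ConnesMoscovici2022, Lemma 1.5 and its proof (= arXiv:2112.05500 Lemma 2.5, chunk p0005:L84–L104)] -/
theorem existsUnique_coeffs_of_independent_mod {lam : ℝ} (hlam : 0 < lam)
    (v : Fin 8 → L2R) (hv : ∀ i, v i ∈ (prolateMax lam).domain)
    (hind : ∀ c : Fin 8 → ℂ, (∑ i, c i • v i) ∈ (prolateMin lam).domain → c = 0)
    {ξ : L2R} (hξ : ξ ∈ (prolateMax lam).domain) :
    ∃! c : Fin 8 → ℂ, ξ - ∑ i, c i • v i ∈ (prolateMin lam).domain :=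
  existsUnique_coeffs_of_independent_mod_of_finrank_eq (finrank_prolateMax_quotient_eq_eight hlam)
    (finiteDimensional_prolateMax_quotient hlam) v hv hind hξ

/-- at most `8` vectors of `dom W_max` can be independent modulo `dom W_min` [cite: ConnesMoscovici2022, Lemma 1.5 (= arXiv:2112.05500 Lemma 2.5, chunk p0005:L84–L104) with Lemma 1.1 (= arXiv Lemma 2.1)] -/
theorem le_eight_of_independent_mod {lam : ℝ} (hlam : 0 < lam) {n : ℕ}
    (v : Fin n → L2R) (hv : ∀ i, v i ∈ (prolateMax lam).domain)
    (hind : ∀ c : Fin n → ℂ, (∑ i, c i • v i) ∈ (prolateMin lam).domain → c = 0) : n ≤ 8 := by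
  set Dq : Submodule ℂ ↥((prolateMax lam).domain) :=
    (prolateMin lam).domain.comap (prolateMax lam).domain.subtype with hDq
  haveI := finiteDimensional_prolateMax_quotient hlam
  set w : Fin n → ↥((prolateMax lam).domain) := fun i => ⟨v i, hv i⟩ with hw
  set Φ : (Fin n → ℂ) →ₗ[ℂ] (↥((prolateMax lam).domain) ⧸ Dq) :=
    Dq.mkQ.comp (Fintype.linearCombination ℂ w) with hΦ
  have hΦ_apply : ∀ c : Fin n → ℂ, Φ c = Dq.mkQ (∑ i, c i • w i) := by
    intro c; simp [hΦ, Fintype.linearCombination_apply]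
  have hsum : ∀ c : Fin n → ℂ, (((∑ i, c i • w i : ↥((prolateMax lam).domain))) : L2R) = ∑ i, c i • v i := by
    intro c; simp [hw]
  have hinj : Function.Injective Φ := by
    rw [← LinearMap.ker_eq_bot, LinearMap.ker_eq_bot']
    intro c hc
    rw [hΦ_apply, Submodule.mkQ_apply, Submodule.Quotient.mk_eq_zero, hDq, Submodule.mem_comap,
      Submodule.subtype_apply, hsum] at hc
    exact hind c hc
  have h := LinearMap.finrank_le_finrank_of_injective hinj
  rwa [Module.finrank_fin_fun, finrank_prolateMax_quotient_eq_eight hlam] at h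

/-- conversely, uniqueness of coefficients (tested at `ξ = 0`) gives independence modulo `dom W_min` [cite: ConnesMoscovici2022, Lemma 1.5 and its proof (= arXiv:2112.05500 Lemma 2.5, chunk p0005:L84–L104)] -/
theorem independent_mod_of_existsUnique_coeffs {lam : ℝ} {n : ℕ} (v : Fin n → L2R)
    (h : ∃! c : Fin n → ℂ, (0 : L2R) - ∑ i, c i • v i ∈ (prolateMin lam).domain) :
    ∀ c : Fin n → ℂ, (∑ i, c i • v i) ∈ (prolateMin lam).domain → c = 0 := by
  intro c hc
  have h0 : (0 : L2R) - ∑ i, (0 : Fin n → ℂ) i • v i ∈ (prolateMin lam).domain := by simp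
  have hc' : (0 : L2R) - ∑ i, c i • v i ∈ (prolateMin lam).domain := by
    rw [zero_sub]; exact Submodule.neg_mem _ hc
  exact h.unique hc' h0

/-! ### The `Ω`-pairing criterion for independence modulo `dom W_min` -/

/-- `Ω(ξ, η) = 0` when `η ∈ dom W_min`. [cite: ConnesMoscovici2022, §1 eq. (1.4) and the sentence around it, «Ω … descends to a non-degenerate form on ℰ» (= arXiv:2112.05500 eq. (2.4), arXiv p. 4)] -/
theorem omegaForm_eq_zero_of_mem_prolateMin_right {lam : ℝ} (ξ η : (prolateMax lam).domain)
    (hη : (η : L2R) ∈ (prolateMin lam).domain) : omegaForm lam ξ η = 0 := by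
  rw [omegaForm, inner_prolateMax_comm_of_mem_prolateMin_right ξ η hη, sub_self, mul_zero]

/-- `Ω(ξ, η) = 0` when `ξ ∈ dom W_min`. [cite: ConnesMoscovici2022, §1 eq. (1.4) and the sentence around it, «Ω … descends to a non-degenerate form on ℰ» (= arXiv:2112.05500 eq. (2.4), arXiv p. 4)] -/
theorem omegaForm_eq_zero_of_mem_prolateMin_left {lam : ℝ} (ξ η : (prolateMax lam).domain)
    (hξ : (ξ : L2R) ∈ (prolateMin lam).domain) : omegaForm lam ξ η = 0 := by
  rw [omegaForm, inner_prolateMax_comm_of_mem_prolateMin_left ξ η hξ, sub_self, mul_zero]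

/-- `Ω` is additive in the second slot. [cite: ConnesMoscovici2022, §1 eq. (1.4) and the sentence around it, «Ω … descends to a non-degenerate form on ℰ» (= arXiv:2112.05500 eq. (2.4), arXiv p. 4)] -/
theorem omegaForm_add_right {lam : ℝ} (ξ η η' : (prolateMax lam).domain) :
    omegaForm lam ξ (η + η') = omegaForm lam ξ η + omegaForm lam ξ η' := by
  simp only [omegaForm, LinearPMap.map_add, Submodule.coe_add, inner_add_right]
  ring

/-- `Ω` is `ℂ`-linear in the second slot. [cite: ConnesMoscovici2022, §1 eq. (1.4) and the sentence around it, «Ω … descends to a non-degenerate form on ℰ» (= arXiv:2112.05500 eq. (2.4), arXiv p. 4)] -/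
theorem omegaForm_smul_right {lam : ℝ} (ξ η : (prolateMax lam).domain) (c : ℂ) :
    omegaForm lam ξ (c • η) = c * omegaForm lam ξ η := by
  simp only [omegaForm, LinearPMap.map_smul, Submodule.coe_smul, inner_smul_right]
  ring

/-- `Ω` is Hermitian: `Ω(η, ξ) = conj Ω(ξ, η)` (`Ω = −i ×` an anti-Hermitian form). [cite: ConnesMoscovici2022, §1 eq. (1.4) and the sentence around it, «Ω … descends to a non-degenerate form on ℰ» (= arXiv:2112.05500 eq. (2.4), arXiv p. 4)] -/
theorem omegaForm_swap {lam : ℝ} (ξ η : (prolateMax lam).domain) :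
    omegaForm lam η ξ = conj (omegaForm lam ξ η) := by
  simp only [omegaForm, _root_.map_mul, _root_.map_sub, _root_.map_neg, Complex.conj_I, inner_conj_symm]
  ring

/-- `Ω(ξ, ∑ cᵢ ηᵢ) = ∑ cᵢ Ω(ξ, ηᵢ)`. [cite: ConnesMoscovici2022, §1 eq. (1.4) and the sentence around it, «Ω … descends to a non-degenerate form on ℰ» (= arXiv:2112.05500 eq. (2.4), arXiv p. 4)] -/
theorem omegaForm_sum_smul_right {lam : ℝ} {n : ℕ} (ξ : (prolateMax lam).domain)
    (w : Fin n → (prolateMax lam).domain) (c : Fin n → ℂ) :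
    omegaForm lam ξ (∑ i, c i • w i) = ∑ i, c i * omegaForm lam ξ (w i) := by
  let L : ↥((prolateMax lam).domain) →ₗ[ℂ] ℂ :=
    { toFun := omegaForm lam ξ
      map_add' := omegaForm_add_right ξ
      map_smul' := fun c η => omegaForm_smul_right ξ η c }
  have hL : ∀ η, L η = omegaForm lam ξ η := fun _ => rfl
  rw [← hL, map_sum]
  exact Finset.sum_congr rfl fun i _ => by rw [LinearMap.map_smul, hL, smul_eq_mul]

/-- **The `Ω`-matrix criterion** (the mechanism of the printed proof of Lemma 1.5): if the matrix
`(Ω(vⱼ, vᵢ))ⱼᵢ` of `n` vectors of `dom W_max` has trivial kernel, the vectors are linearly independent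
modulo `dom W_min` — because `Ω(vⱼ, ·)` kills `dom W_min`. [cite: ConnesMoscovici2022, Lemma 1.5 and its proof (= arXiv:2112.05500 Lemma 2.5, chunk p0005:L84–L104)] -/
theorem independent_mod_of_omegaMatrix {lam : ℝ} {n : ℕ} (v : Fin n → L2R)
    (hv : ∀ i, v i ∈ (prolateMax lam).domain)
    (hM : ∀ c : Fin n → ℂ, (∀ j, ∑ i, omegaForm lam ⟨v j, hv j⟩ ⟨v i, hv i⟩ * c i = 0) → c = 0) :
    ∀ c : Fin n → ℂ, (∑ i, c i • v i) ∈ (prolateMin lam).domain → c = 0 := by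
  intro c hc
  apply hM c
  intro j
  set w : Fin n → ↥((prolateMax lam).domain) := fun i => ⟨v i, hv i⟩ with hw
  have hsum : (((∑ i, c i • w i : ↥((prolateMax lam).domain))) : L2R) = ∑ i, c i • v i := by
    simp [hw]
  have h0 : omegaForm lam (w j) (∑ i, c i • w i) = 0 :=
    omegaForm_eq_zero_of_mem_prolateMin_right _ _ (by rw [hsum]; exact hc)
  rw [omegaForm_sum_smul_right] at h0
  rw [← h0]
  exact Finset.sum_congr rfl fun i _ => mul_comm _ _

/-- Matrix form: `det (Ω(vⱼ, vᵢ)) ≠ 0` ⟹ independence modulo `dom W_min`. [cite: ConnesMoscovici2022, Lemma 1.5 and its proof (= arXiv:2112.05500 Lemma 2.5, chunk p0005:L84–L104)] -/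
theorem independent_mod_of_det_omegaMatrix_ne_zero {lam : ℝ} {n : ℕ} (v : Fin n → L2R)
    (hv : ∀ i, v i ∈ (prolateMax lam).domain)
    (hdet : (Matrix.of fun j i => omegaForm lam ⟨v j, hv j⟩ ⟨v i, hv i⟩).det ≠ 0) :
    ∀ c : Fin n → ℂ, (∑ i, c i • v i) ∈ (prolateMin lam).domain → c = 0 := by
  refine independent_mod_of_omegaMatrix v hv fun c hc => ?_
  refine Matrix.eq_zero_of_mulVec_eq_zero hdet ?_
  funext j
  rw [Matrix.mulVec, Pi.zero_apply]
  change ∑ i, (Matrix.of fun j i => omegaForm lam ⟨v j, hv j⟩ ⟨v i, hv i⟩) j i * c i = 0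
  simpa using hc j

/-- **Basis from the `Ω`-matrix**: eight vectors of `dom W_max` whose `Ω`-matrix has trivial kernel
form a basis of `dom W_max / dom W_min`. [cite: ConnesMoscovici2022, Lemma 1.5 and its proof (= arXiv:2112.05500 Lemma 2.5, chunk p0005:L84–L104)] -/
theorem existsUnique_coeffs_of_omegaMatrix {lam : ℝ} (hlam : 0 < lam)
    (v : Fin 8 → L2R) (hv : ∀ i, v i ∈ (prolateMax lam).domain)
    (hM : ∀ c : Fin 8 → ℂ, (∀ j, ∑ i, omegaForm lam ⟨v j, hv j⟩ ⟨v i, hv i⟩ * c i = 0) → c = 0)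
    {ξ : L2R} (hξ : ξ ∈ (prolateMax lam).domain) :
    ∃! c : Fin 8 → ℂ, ξ - ∑ i, c i • v i ∈ (prolateMin lam).domain :=
  existsUnique_coeffs_of_independent_mod hlam v hv (independent_mod_of_omegaMatrix v hv hM) hξ

/-! ### Lemma 1.5 (corrected statement) reduced to membership + independence / the `Ω`-matrix -/

/-- **`CM22_lemma_1_5_corr` ⇐ membership + independence modulo `dom W_min`**: for the data of the
corrected Lemma 1.5 it suffices that the eight vectors `α±, β±, α̂±, β̂±` lie in `dom W_max` and are
linearly independent modulo `dom W_min`; spanning is automatic (`dim = 4 + 4 = 8`). [cite: ConnesMoscovici2022, Lemma 1.5 (= arXiv:2112.05500 Lemma 2.5, chunk p0005:L84–L104) with Lemma 1.1 (= arXiv Lemma 2.1)] -/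
theorem CM22_lemma_1_5_corr_of_independent
    (hind : ∀ lam : ℝ, 0 < lam →
      ∀ (α : ℝ → ℝ), ContDiffOn ℝ (⊤ : ℕ∞) α {x | x ≠ lam ∧ x ≠ -lam} → (∀ x, α (-x) = α x) →
        (∀ x ∈ Icc (3 / 4 * lam) (5 / 4 * lam), α x = Real.log |lam ^ 2 - x ^ 2|) →
        (∀ x, 0 ≤ x → α x ≠ 0 → x ∈ Ioo (lam / 2) (3 / 2 * lam)) →
      ∀ (αp αm βp βm : L2R),
        ((αp : ℝ → ℂ) =ᵐ[volume] fun x ↦ (α x : ℂ)) →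
        ((αm : ℝ → ℂ) =ᵐ[volume] fun x ↦ (x * α x : ℂ)) →
        ((βp : ℝ → ℂ) =ᵐ[volume] (Icc (-lam) lam).indicator fun _ ↦ (1 : ℂ)) →
        ((βm : ℝ → ℂ) =ᵐ[volume] (Icc (-lam) lam).indicator fun x ↦ (x : ℂ)) →
        let v : Fin 8 → L2R := ![αp, αm, βp, βm, fourierL2 αp, fourierL2 αm, fourierL2 βp, fourierL2 βm]
        (∀ i, v i ∈ (prolateMax lam).domain) ∧
        ∀ c : Fin 8 → ℂ, (∑ i, c i • v i) ∈ (prolateMin lam).domain → c = 0) :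
    CM22_lemma_1_5_corr := by
  intro lam hlam α hα1 hα2 hα3 hα4 αp αm βp βm h1 h2 h3 h4 v
  obtain ⟨hv, hi⟩ := hind lam hlam α hα1 hα2 hα3 hα4 αp αm βp βm h1 h2 h3 h4
  exact ⟨hv, fun ξ hξ => existsUnique_coeffs_of_independent_mod hlam v hv hi hξ⟩

/-- **`CM22_lemma_1_5_corr` ⇐ membership + the `Ω`-matrix has trivial kernel** — the printed proof's
road ("the matrix representation of `Ω` with respect to the given quadruplet has a single nonzero
entry in each row and column"): what remains is the membership of the eight vectors in `dom W_max`
and the computation of their `Ω`-pairings. [cite: ConnesMoscovici2022, Lemma 1.5 (= arXiv:2112.05500 Lemma 2.5, chunk p0005:L84–L104) with Lemma 1.1 (= arXiv Lemma 2.1)] -/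
theorem CM22_lemma_1_5_corr_of_omegaMatrix
    (hΩ : ∀ lam : ℝ, 0 < lam →
      ∀ (α : ℝ → ℝ), ContDiffOn ℝ (⊤ : ℕ∞) α {x | x ≠ lam ∧ x ≠ -lam} → (∀ x, α (-x) = α x) →
        (∀ x ∈ Icc (3 / 4 * lam) (5 / 4 * lam), α x = Real.log |lam ^ 2 - x ^ 2|) →
        (∀ x, 0 ≤ x → α x ≠ 0 → x ∈ Ioo (lam / 2) (3 / 2 * lam)) →
      ∀ (αp αm βp βm : L2R),
        ((αp : ℝ → ℂ) =ᵐ[volume] fun x ↦ (α x : ℂ)) →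
        ((αm : ℝ → ℂ) =ᵐ[volume] fun x ↦ (x * α x : ℂ)) →
        ((βp : ℝ → ℂ) =ᵐ[volume] (Icc (-lam) lam).indicator fun _ ↦ (1 : ℂ)) →
        ((βm : ℝ → ℂ) =ᵐ[volume] (Icc (-lam) lam).indicator fun x ↦ (x : ℂ)) →
        let v : Fin 8 → L2R := ![αp, αm, βp, βm, fourierL2 αp, fourierL2 αm, fourierL2 βp, fourierL2 βm]
        ∃ hv : ∀ i, v i ∈ (prolateMax lam).domain,
        ∀ c : Fin 8 → ℂ, (∀ j, ∑ i, omegaForm lam ⟨v j, hv j⟩ ⟨v i, hv i⟩ * c i = 0) → c = 0) :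
    CM22_lemma_1_5_corr := by
  refine CM22_lemma_1_5_corr_of_independent ?_
  intro lam hlam α hα1 hα2 hα3 hα4 αp αm βp βm h1 h2 h3 h4 v
  obtain ⟨hv, hM⟩ := hΩ lam hlam α hα1 hα2 hα3 hα4 αp αm βp βm h1 h2 h3 h4
  exact ⟨hv, independent_mod_of_omegaMatrix v hv hM⟩

/-! ### A rectangular `Ω`-criterion (test vectors `v`, candidate vectors `u`) -/

/-- **Rectangular `Ω`-matrix criterion**: if for `u₁ … uₙ ∈ dom W_max` there are test vectors
`v₁ … vₘ ∈ dom W_max` such that `(Ω(vⱼ, uᵢ))ⱼᵢ` has trivial kernel, then the `uᵢ` are linearly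
independent modulo `dom W_min` (e.g. the four `β±, β̂±` tested against the four `α±, α̂±`: in the
printed `Ω`-matrix each `β` pairs with exactly one `α`). [cite: ConnesMoscovici2022, Lemma 1.5 and its proof (= arXiv:2112.05500 Lemma 2.5, chunk p0005:L84–L104)] -/
theorem independent_mod_of_omegaMatrix₂ {lam : ℝ} {n m : ℕ} (u : Fin n → L2R)
    (hu : ∀ i, u i ∈ (prolateMax lam).domain) (v : Fin m → L2R)
    (hv : ∀ j, v j ∈ (prolateMax lam).domain)
    (hM : ∀ c : Fin n → ℂ, (∀ j, ∑ i, omegaForm lam ⟨v j, hv j⟩ ⟨u i, hu i⟩ * c i = 0) → c = 0) :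
    ∀ c : Fin n → ℂ, (∑ i, c i • u i) ∈ (prolateMin lam).domain → c = 0 := by
  intro c hc
  apply hM c
  intro j
  set w : Fin n → ↥((prolateMax lam).domain) := fun i => ⟨u i, hu i⟩ with hw
  have hsum : (((∑ i, c i • w i : ↥((prolateMax lam).domain))) : L2R) = ∑ i, c i • u i := by
    simp [hw]
  have h0 : omegaForm lam ⟨v j, hv j⟩ (∑ i, c i • w i) = 0 :=
    omegaForm_eq_zero_of_mem_prolateMin_right _ _ (by rw [hsum]; exact hc)
  rw [omegaForm_sum_smul_right] at h0
  rw [← h0]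
  exact Finset.sum_congr rfl fun i _ => mul_comm _ _

/-! ### Self-adjoint extensions of `W_min`: self-adjointness by dimension count, maximality
(the abstract doors to Thm 1.6 (i) and (iii)) -/

/-- plumbing: two restrictions `A, B ≤ C` with `dom A ≤ dom B` satisfy `A ≤ B`. [folklore] -/
private theorem le_of_le_of_le_of_domain_le {A B C : L2R →ₗ.[ℂ] L2R} (hA : A ≤ C) (hB : B ≤ C)
    (hAB : A.domain ≤ B.domain) : A ≤ B := by
  refine ⟨hAB, fun x y hxy => ?_⟩
  have e1 : A x = C ⟨x, hA.1 x.2⟩ := hA.2 rfl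
  have e2 : B y = C ⟨y, hB.1 y.2⟩ := hB.2 rfl
  rw [e1, e2]
  congr 1
  exact Subtype.ext hxy

/-- A symmetric extension `S` of `W_min` sits below `W_max` (`W_min ⊂ S ⊂ S* ⊂ W_min* = W_max`): the
symmetric extensions of `W_min` are restrictions of `W_max`, i.e. subspaces of `ℰ`. [cite: ConnesMoscovici2022, §1, the `ℰ`-paragraph after Lemma 1.3, «the selfadjoint extensions of `W_min` are parametrized by self-orthogonal subspaces of `ℰ`» (= arXiv:2112.05500 arXiv p. 4) and Thm 1.6 (i)/(iii) with its proof (= arXiv Thm 2.6, chunk p0006:L81–L114); EdmundsEvans2018, Ch. III §4 Thm 4.8 with (4.11)] -/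
theorem le_prolateMax_of_prolateMin_le_of_isSymmetric {lam : ℝ} {S : L2R →ₗ.[ℂ] L2R}
    (hWS : prolateMin lam ≤ S) (hS : S.IsSymmetric) : S ≤ prolateMax lam := by
  have h := le_adjoint_of_isSymmetric_of_le (dense_prolateMin_domain lam) hWS hS
  rwa [adjoint_prolateMin] at h

/-- A self-adjoint extension of `W_min` sits below `W_max`. [cite: ConnesMoscovici2022, §1, the `ℰ`-paragraph after Lemma 1.3, «the selfadjoint extensions of `W_min` are parametrized by self-orthogonal subspaces of `ℰ`» (= arXiv:2112.05500 arXiv p. 4) and Thm 1.6 (i)/(iii) with its proof (= arXiv Thm 2.6, chunk p0006:L81–L114); EdmundsEvans2018, Ch. III §4 Thm 4.8 with (4.11)] -/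
theorem le_prolateMax_of_prolateMin_le_of_isSelfAdjoint {lam : ℝ} {S : L2R →ₗ.[ℂ] L2R}
    (hWS : prolateMin lam ≤ S) (hS : IsSelfAdjoint S) : S ≤ prolateMax lam :=
  le_prolateMax_of_prolateMin_le_of_isSymmetric hWS hS.isSymmetric_linearPMap

/-- **Self-adjointness by dimension count for the prolate operator** (deficiency indices `(4,4)`):
a symmetric extension `S ⊇ W_min` whose domain contains four vectors linearly independent modulo
`dom W_min` is self-adjoint (then `dom S / dom W_min` is a 4-dimensional = maximal self-orthogonal
subspace of the 8-dimensional `ℰ`). [cite: ConnesMoscovici2022, §1, the `ℰ`-paragraph after Lemma 1.3, «the selfadjoint extensions of `W_min` are parametrized by self-orthogonal subspaces of `ℰ`» (= arXiv:2112.05500 arXiv p. 4) and Thm 1.6 (i)/(iii) with its proof (= arXiv Thm 2.6, chunk p0006:L81–L114); EdmundsEvans2018, Ch. III §4 Thm 4.8 with (4.11)] -/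
theorem isSelfAdjoint_of_prolateMin_le_of_independent {lam : ℝ} (hlam : 0 < lam)
    {S : L2R →ₗ.[ℂ] L2R} (hWS : prolateMin lam ≤ S) (hS : S.IsSymmetric)
    (u : Fin 4 → L2R) (hu : ∀ i, u i ∈ S.domain)
    (hind : ∀ c : Fin 4 → ℂ, (∑ i, c i • u i) ∈ (prolateMin lam).domain → c = 0) :
    IsSelfAdjoint S := by
  haveI : FiniteDimensional ℂ ((prolateMin lam)†.eigenspace I) := by
    rw [adjoint_prolateMin]; exact finiteDimensional_eigenspace_prolateMax hlam I
  haveI : FiniteDimensional ℂ ((prolateMin lam)†.eigenspace (-I)) := by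
    rw [adjoint_prolateMin]; exact finiteDimensional_eigenspace_prolateMax hlam (-I)
  have hp : Module.finrank ℂ ((prolateMin lam)†.eigenspace I) ≤ 4 := by
    rw [adjoint_prolateMin]; exact (finrank_eigenspace_prolateMax hlam I).le
  have hm : Module.finrank ℂ ((prolateMin lam)†.eigenspace (-I)) ≤ 4 := by
    rw [adjoint_prolateMin]; exact (finrank_eigenspace_prolateMax hlam (-I)).le
  exact isSelfAdjoint_of_isSymmetric_of_independent (prolateMin_isSymmetric lam)
    (isClosed_prolateMin lam) (dense_prolateMin_domain lam) hWS hS hp hm u hu hind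

/-- The same with independence certified by a rectangular `Ω`-matrix against four test vectors of
`dom W_max` (the `β`'s tested against the `α`'s). [cite: ConnesMoscovici2022, §1, the `ℰ`-paragraph after Lemma 1.3, «the selfadjoint extensions of `W_min` are parametrized by self-orthogonal subspaces of `ℰ`» (= arXiv:2112.05500 arXiv p. 4) and Thm 1.6 (i)/(iii) with its proof (= arXiv Thm 2.6, chunk p0006:L81–L114); EdmundsEvans2018, Ch. III §4 Thm 4.8 with (4.11)] -/
theorem isSelfAdjoint_of_prolateMin_le_of_omegaMatrix {lam : ℝ} (hlam : 0 < lam)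
    {S : L2R →ₗ.[ℂ] L2R} (hWS : prolateMin lam ≤ S) (hS : S.IsSymmetric)
    (u : Fin 4 → L2R) (hu : ∀ i, u i ∈ S.domain) (v : Fin 4 → L2R)
    (hv : ∀ j, v j ∈ (prolateMax lam).domain)
    (hM : ∀ c : Fin 4 → ℂ, (∀ j, ∑ i, omegaForm lam ⟨v j, hv j⟩
      ⟨u i, (le_prolateMax_of_prolateMin_le_of_isSymmetric hWS hS).1 (hu i)⟩ * c i = 0) → c = 0) :
    IsSelfAdjoint S :=
  isSelfAdjoint_of_prolateMin_le_of_independent hlam hWS hS u hu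
    (independent_mod_of_omegaMatrix₂ u _ v hv hM)

/-- `W_min ≤ W_sa` as soon as `dom W_min ⊆ 𝓛_β` (both are restrictions of `W_max`). [cite: ConnesMoscovici2022, §1, the `ℰ`-paragraph after Lemma 1.3, «the selfadjoint extensions of `W_min` are parametrized by self-orthogonal subspaces of `ℰ`» (= arXiv:2112.05500 arXiv p. 4) and Thm 1.6 (i)/(iii) with its proof (= arXiv Thm 2.6, chunk p0006:L81–L114); EdmundsEvans2018, Ch. III §4 Thm 4.8 with (4.11)] -/
theorem prolateMin_le_prolateSA {lam : ℝ} (hlam : 0 < lam)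
    (hmin : (prolateMin lam).domain ≤ prolateSADomain lam hlam) :
    prolateMin lam ≤ prolateSA lam hlam :=
  le_of_le_of_le_of_domain_le (prolateMin_le_prolateMax lam) (isProlateSA_prolateSA hlam).1
    (by rw [prolateSA_domain hlam]; exact hmin)

/-- `W_sa` is symmetric as soon as `⟪W_max ξ₁, ξ₂⟫ = ⟪ξ₁, W_max ξ₂⟫` on `𝓛_β` (the form in which the
symmetric half of Thm 1.6 (i) is being proved in the tree, `UVProlateSymmetryReduction.lean`). [cite: ConnesMoscovici2022, §1, the `ℰ`-paragraph after Lemma 1.3, «the selfadjoint extensions of `W_min` are parametrized by self-orthogonal subspaces of `ℰ`» (= arXiv:2112.05500 arXiv p. 4) and Thm 1.6 (i)/(iii) with its proof (= arXiv Thm 2.6, chunk p0006:L81–L114); EdmundsEvans2018, Ch. III §4 Thm 4.8 with (4.11)] -/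
theorem prolateSA_isSymmetric_of {lam : ℝ} (hlam : 0 < lam)
    (h : ∀ ξ₁ ξ₂ : (prolateMax lam).domain, (ξ₁ : L2R) ∈ prolateSASet lam →
      (ξ₂ : L2R) ∈ prolateSASet lam →
      ⟪(prolateMax lam ξ₁ : L2R), (ξ₂ : L2R)⟫_ℂ = ⟪(ξ₁ : L2R), (prolateMax lam ξ₂ : L2R)⟫_ℂ) :
    (prolateSA lam hlam).IsSymmetric := by
  intro x y
  have hle : prolateSA lam hlam ≤ prolateMax lam := (isProlateSA_prolateSA hlam).1
  have hx : ((x : L2R)) ∈ prolateSASet lam := by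
    rw [← mem_prolateSADomain hlam, ← prolateSA_domain hlam]; exact x.2
  have hy : ((y : L2R)) ∈ prolateSASet lam := by
    rw [← mem_prolateSADomain hlam, ← prolateSA_domain hlam]; exact y.2
  have ex : (prolateSA lam hlam x : L2R) = prolateMax lam ⟨x, hle.1 x.2⟩ := hle.2 rfl
  have ey : (prolateSA lam hlam y : L2R) = prolateMax lam ⟨y, hle.1 y.2⟩ := hle.2 rfl
  rw [ex, ey]
  exact h ⟨x, hle.1 x.2⟩ ⟨y, hle.1 y.2⟩ hx hy

/-- **Door to Thm 1.6 (i), self-adjointness of `W_sa`**: `W_sa` is self-adjoint as soon as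
(a) `dom W_min ⊆ 𝓛_β`, (b) `W_sa` is symmetric, and (c) `𝓛_β` contains four vectors (the printed
`β±, β̂±`) linearly independent modulo `dom W_min`. [cite: ConnesMoscovici2022, §1, the `ℰ`-paragraph after Lemma 1.3, «the selfadjoint extensions of `W_min` are parametrized by self-orthogonal subspaces of `ℰ`» (= arXiv:2112.05500 arXiv p. 4) and Thm 1.6 (i)/(iii) with its proof (= arXiv Thm 2.6, chunk p0006:L81–L114); EdmundsEvans2018, Ch. III §4 Thm 4.8 with (4.11)] -/
theorem isSelfAdjoint_prolateSA_of_independent {lam : ℝ} (hlam : 0 < lam)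
    (hmin : (prolateMin lam).domain ≤ prolateSADomain lam hlam)
    (hsym : (prolateSA lam hlam).IsSymmetric)
    (u : Fin 4 → L2R) (hu : ∀ i, u i ∈ prolateSASet lam)
    (hind : ∀ c : Fin 4 → ℂ, (∑ i, c i • u i) ∈ (prolateMin lam).domain → c = 0) :
    IsSelfAdjoint (prolateSA lam hlam) :=
  isSelfAdjoint_of_prolateMin_le_of_independent hlam (prolateMin_le_prolateSA hlam hmin) hsym u
    (fun i => by rw [prolateSA_domain hlam]; exact hu i) hind

/-- **Maximality (door to Thm 1.6 (iii))**: a self-adjoint `W ≤ W_max` and a self-adjoint extension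
`W'` of `W_min` with `dom W ⊆ dom W'` coincide («cannot be larger due to self-adjointness»). [cite: ConnesMoscovici2022, §1, the `ℰ`-paragraph after Lemma 1.3, «the selfadjoint extensions of `W_min` are parametrized by self-orthogonal subspaces of `ℰ`» (= arXiv:2112.05500 arXiv p. 4) and Thm 1.6 (i)/(iii) with its proof (= arXiv Thm 2.6, chunk p0006:L81–L114); EdmundsEvans2018, Ch. III §4 Thm 4.8 with (4.11)] -/
theorem eq_of_isSelfAdjoint_of_prolateMin_le_of_domain_le {lam : ℝ} {W W' : L2R →ₗ.[ℂ] L2R}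
    (hW : IsSelfAdjoint W) (hWmax : W ≤ prolateMax lam) (hW' : IsSelfAdjoint W')
    (hmin : prolateMin lam ≤ W') (hdom : W.domain ≤ W'.domain) : W' = W := by
  have hW'max : W' ≤ prolateMax lam := le_prolateMax_of_prolateMin_le_of_isSelfAdjoint hmin hW'
  exact (eq_of_isSelfAdjoint_of_le hW hW' (le_of_le_of_le_of_domain_le hWmax hW'max hdom)).symm

/-- The same in the vocabulary of `CM22_thm_1_6` (iii): once `W_sa` (`IsProlateSA λ W`) is
self-adjoint, any self-adjoint extension `W'` of `W_min` whose domain contains `𝓛_β` IS `W_sa` — what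
remains of (iii) is that commuting with `P_λ`, `P̂_λ` forces `𝓛_β ⊆ dom W'`. [cite: ConnesMoscovici2022, §1, the `ℰ`-paragraph after Lemma 1.3, «the selfadjoint extensions of `W_min` are parametrized by self-orthogonal subspaces of `ℰ`» (= arXiv:2112.05500 arXiv p. 4) and Thm 1.6 (i)/(iii) with its proof (= arXiv Thm 2.6, chunk p0006:L81–L114); EdmundsEvans2018, Ch. III §4 Thm 4.8 with (4.11)] -/
theorem IsProlateSA.eq_of_isSelfAdjoint_of_subset {lam : ℝ} {W W' : L2R →ₗ.[ℂ] L2R}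
    (hWsa : IsProlateSA lam W) (hW : IsSelfAdjoint W) (hW' : IsSelfAdjoint W')
    (hmin : prolateMin lam ≤ W') (hdom : prolateSASet lam ⊆ (W'.domain : Set L2R)) : W' = W :=
  eq_of_isSelfAdjoint_of_prolateMin_le_of_domain_le hW hWsa.1 hW' hmin
    (fun x hx => hdom (by rw [← hWsa.2]; exact hx))

/-! ### The domain of a symmetric extension of `W_min` with four independent vectors:
`dom S = dom W_min ∔ span{u₁, …, u₄}` -/

/-- at most four vectors of a symmetric extension of `W_min` are independent modulo `dom W_min`
(`dim dom S / dom W_min ≤ m₊ = 4`). [cite: ConnesMoscovici2022, Thm 1.6 (ii), proof, first sentence: «every element of `𝓛_β` is a linear combination of an element `ξ ∈ Dom W_min` and the 4 vectors `β±, β̂±`» (= arXiv:2112.05500 Thm 2.6, chunk p0006:L81–L114), with the `ℰ`-paragraph after Lemma 1.3; EdmundsEvans2018, Ch. III §4 Thm 4.8 (4.10)–(4.11)] -/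
theorem le_four_of_prolateMin_le_of_independent {lam : ℝ} (hlam : 0 < lam) {S : L2R →ₗ.[ℂ] L2R}
    (hWS : prolateMin lam ≤ S) (hS : S.IsSymmetric) {d : ℕ} (u : Fin d → L2R)
    (hu : ∀ i, u i ∈ S.domain)
    (hind : ∀ c : Fin d → ℂ, (∑ i, c i • u i) ∈ (prolateMin lam).domain → c = 0) : d ≤ 4 := by
  haveI : FiniteDimensional ℂ ((prolateMin lam)†.eigenspace I) := by
    rw [adjoint_prolateMin]; exact finiteDimensional_eigenspace_prolateMax hlam I
  have h := card_le_finrank_deficiency_of_isSymmetric (prolateMin_isSymmetric lam)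
    (isClosed_prolateMin lam) (dense_prolateMin_domain lam) hWS hS u hu hind
  have h4 : Module.finrank ℂ ((prolateMin lam)†.eigenspace I) = 4 := by
    rw [adjoint_prolateMin]; exact finrank_eigenspace_prolateMax hlam I
  omega

/-- **Four vectors independent modulo `dom W_min` span a symmetric extension modulo `dom W_min`**:
for a symmetric `S ⊇ W_min` and `u₁, …, u₄ ∈ dom S` independent modulo `dom W_min`, every `x ∈ dom S`
is `x ≡ ∑ cᵢ uᵢ (mod dom W_min)` for a unique `c ∈ ℂ⁴`. [cite: ConnesMoscovici2022, Thm 1.6 (ii), proof, first sentence: «every element of `𝓛_β` is a linear combination of an element `ξ ∈ Dom W_min` and the 4 vectors `β±, β̂±`» (= arXiv:2112.05500 Thm 2.6, chunk p0006:L81–L114), with the `ℰ`-paragraph after Lemma 1.3; EdmundsEvans2018, Ch. III §4 Thm 4.8 (4.10)–(4.11)] -/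
theorem existsUnique_coeffs_of_prolateMin_le_of_independent {lam : ℝ} (hlam : 0 < lam)
    {S : L2R →ₗ.[ℂ] L2R} (hWS : prolateMin lam ≤ S) (hS : S.IsSymmetric)
    (u : Fin 4 → L2R) (hu : ∀ i, u i ∈ S.domain)
    (hind : ∀ c : Fin 4 → ℂ, (∑ i, c i • u i) ∈ (prolateMin lam).domain → c = 0)
    {x : L2R} (hx : x ∈ S.domain) :
    ∃! c : Fin 4 → ℂ, x - ∑ i, c i • u i ∈ (prolateMin lam).domain := by
  haveI : FiniteDimensional ℂ ((prolateMin lam)†.eigenspace I) := by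
    rw [adjoint_prolateMin]; exact finiteDimensional_eigenspace_prolateMax hlam I
  have h4 : Module.finrank ℂ ((prolateMin lam)†.eigenspace I) ≤ 4 := by
    rw [adjoint_prolateMin]; exact (finrank_eigenspace_prolateMax hlam I).le
  exact existsUnique_coeffs_of_isSymmetric (prolateMin_isSymmetric lam) (isClosed_prolateMin lam)
    (dense_prolateMin_domain lam) hWS hS h4 u hu hind hx

/-- … equivalently `dom S = dom W_min + span{u₁, …, u₄}`. [cite: ConnesMoscovici2022, Thm 1.6 (ii), proof, first sentence: «every element of `𝓛_β` is a linear combination of an element `ξ ∈ Dom W_min` and the 4 vectors `β±, β̂±`» (= arXiv:2112.05500 Thm 2.6, chunk p0006:L81–L114), with the `ℰ`-paragraph after Lemma 1.3; EdmundsEvans2018, Ch. III §4 Thm 4.8 (4.10)–(4.11)] -/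
theorem domain_eq_sup_span_of_prolateMin_le_of_independent {lam : ℝ} (hlam : 0 < lam)
    {S : L2R →ₗ.[ℂ] L2R} (hWS : prolateMin lam ≤ S) (hS : S.IsSymmetric)
    (u : Fin 4 → L2R) (hu : ∀ i, u i ∈ S.domain)
    (hind : ∀ c : Fin 4 → ℂ, (∑ i, c i • u i) ∈ (prolateMin lam).domain → c = 0) :
    S.domain = (prolateMin lam).domain ⊔ Submodule.span ℂ (Set.range u) := by
  apply le_antisymm
  · intro x hx
    obtain ⟨c, hc, -⟩ := existsUnique_coeffs_of_prolateMin_le_of_independent hlam hWS hS u hu hind hx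
    have e : x = (x - ∑ i, c i • u i) + ∑ i, c i • u i := by abel
    rw [e]
    exact Submodule.add_mem_sup hc
      (Submodule.sum_mem _ fun i _ => Submodule.smul_mem _ _ (Submodule.subset_span ⟨i, rfl⟩))
  · refine sup_le hWS.1 (Submodule.span_le.2 ?_)
    rintro _ ⟨i, rfl⟩
    exact hu i

/-- **«Every element of `𝓛_β` is a linear combination of an element of `dom W_min` and the four
vectors `β±, β̂±`»** — granted `dom W_min ⊆ 𝓛_β`, symmetry of `W_sa`, and the independence of the
four vectors modulo `dom W_min`: `𝓛_β = dom W_min + span{u₁, …, u₄}`. [cite: ConnesMoscovici2022, Thm 1.6 (ii), proof, first sentence: «every element of `𝓛_β` is a linear combination of an element `ξ ∈ Dom W_min` and the 4 vectors `β±, β̂±`» (= arXiv:2112.05500 Thm 2.6, chunk p0006:L81–L114), with the `ℰ`-paragraph after Lemma 1.3; EdmundsEvans2018, Ch. III §4 Thm 4.8 (4.10)–(4.11)] -/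
theorem prolateSADomain_eq_sup_span_of_independent {lam : ℝ} (hlam : 0 < lam)
    (hmin : (prolateMin lam).domain ≤ prolateSADomain lam hlam)
    (hsym : (prolateSA lam hlam).IsSymmetric)
    (u : Fin 4 → L2R) (hu : ∀ i, u i ∈ prolateSASet lam)
    (hind : ∀ c : Fin 4 → ℂ, (∑ i, c i • u i) ∈ (prolateMin lam).domain → c = 0) :
    prolateSADomain lam hlam = (prolateMin lam).domain ⊔ Submodule.span ℂ (Set.range u) := by
  rw [← prolateSA_domain hlam]
  exact domain_eq_sup_span_of_prolateMin_le_of_independent hlam (prolateMin_le_prolateSA hlam hmin)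
    hsym u (fun i => by rw [prolateSA_domain hlam]; exact hu i) hind

/-! ### «`W_sa` is selfadjoint by construction»: the Lagrangian door to Thm 1.6 (i)

The printed construction: `𝓛_β = ⋂ₖ Ker L_{bₖ}` with `L_b = iΩ(·, b)` for the four vectors
`b = (β₊, β₋, β̂₊, β̂₋)` of `dom W_max`, which are pairwise `Ω`-orthogonal (in the `Ω`-matrix of
Lemma 1.5 each `β` pairs only with an `α`) and independent modulo `dom W_min`.  For ANY such quadruple
the annihilator `L = {ξ ∈ dom W_max : Ω(ξ, bₖ) = 0 ∀ k}` satisfies: `W_max|_L` is self-adjoint and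
`L = dom W_min ∔ span{bₖ}` — because `U := dom W_min + span{bₖ}` is `Ω`-isotropic, so `W_max|_U` is a
symmetric extension of `W_min` with four independent vectors, hence self-adjoint (dimension count),
and `L ⊆ dom (W_max|_U)† = U ⊆ L`. -/

section Lagrangian

variable {lam : ℝ}

/-- `Ω(η, m + ∑ cₖ bₖ) = ∑ cₖ Ω(η, bₖ)` for `m ∈ dom W_min`. [cite: ConnesMoscovici2022, §1: the `ℰ`-paragraph after Lemma 1.3 («selfadjoint extensions of `W_min` are parametrized by self-orthogonal subspaces of `ℰ`»), eq. (1.15) `𝓛_β = ⋂ Ker L_{β±} ∩ ⋂ Ker L_{β̂±}` with `L_θ = iΩ(·, θ)` (1.11), the Definition of `W_sa`, and Thm 1.6 (i) «`W_sa` is selfadjoint by construction» (= arXiv:2112.05500 (2.11), (2.15), Thm 2.6 (i), arXiv pp. 4–7); EdmundsEvans2018, Ch. III §4 Thm 4.8 with (4.11)] -/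
theorem omegaForm_right_of_eq_add_sum {n : ℕ} (b : Fin n → L2R)
    (hb : ∀ k, b k ∈ (prolateMax lam).domain) (η : (prolateMax lam).domain) {u m : L2R}
    (hm : m ∈ (prolateMin lam).domain) (c : Fin n → ℂ) (hu : u = m + ∑ k, c k • b k)
    (huM : u ∈ (prolateMax lam).domain) :
    omegaForm lam η ⟨u, huM⟩ = ∑ k, c k * omegaForm lam η ⟨b k, hb k⟩ := by
  have hmM : m ∈ (prolateMax lam).domain := (prolateMin_le_prolateMax lam).1 hm
  set w : Fin n → ↥((prolateMax lam).domain) := fun k => ⟨b k, hb k⟩ with hw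
  have e : (⟨u, huM⟩ : (prolateMax lam).domain) = ⟨m, hmM⟩ + ∑ k, c k • w k := by
    apply Subtype.ext
    simp [hw, hu]
  rw [e, omegaForm_add_right, omegaForm_eq_zero_of_mem_prolateMin_right _ _ hm, zero_add,
    omegaForm_sum_smul_right]

/-- `Ω(ξ, η) = 0 ⟹ ⟪W_max ξ, η⟫ = ⟪ξ, W_max η⟫` (`Ω = (1/i)(⟪W_max ξ, η⟫ − ⟪ξ, W_max η⟫)`). [cite: ConnesMoscovici2022, §1: the `ℰ`-paragraph after Lemma 1.3 («selfadjoint extensions of `W_min` are parametrized by self-orthogonal subspaces of `ℰ`»), eq. (1.15) `𝓛_β = ⋂ Ker L_{β±} ∩ ⋂ Ker L_{β̂±}` with `L_θ = iΩ(·, θ)` (1.11), the Definition of `W_sa`, and Thm 1.6 (i) «`W_sa` is selfadjoint by construction» (= arXiv:2112.05500 (2.11), (2.15), Thm 2.6 (i), arXiv pp. 4–7); EdmundsEvans2018, Ch. III §4 Thm 4.8 with (4.11)] -/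
theorem inner_prolateMax_comm_of_omegaForm_eq_zero (ξ η : (prolateMax lam).domain)
    (h : omegaForm lam ξ η = 0) :
    ⟪(prolateMax lam ξ : L2R), (η : L2R)⟫_ℂ = ⟪(ξ : L2R), (prolateMax lam η : L2R)⟫_ℂ := by
  rw [omegaForm] at h
  rcases mul_eq_zero.1 h with h | h
  · exact absurd h (neg_ne_zero.2 Complex.I_ne_zero)
  · exact sub_eq_zero.1 h

/-- **The Lagrangian door («`W_sa` is selfadjoint by construction»)**: let `b₁, …, b₄ ∈ dom W_max` be
pairwise `Ω`-orthogonal and linearly independent modulo `dom W_min`, and let `L ≤ dom W_max` be their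
`Ω`-annihilator, `ξ ∈ L ↔ ∀ k, Ω(ξ, bₖ) = 0`.  Then the restriction `W_max|_L` is SELF-ADJOINT and
`L = dom W_min + span{b₁, …, b₄}`. [cite: ConnesMoscovici2022, §1: the `ℰ`-paragraph after Lemma 1.3 («selfadjoint extensions of `W_min` are parametrized by self-orthogonal subspaces of `ℰ`»), eq. (1.15) `𝓛_β = ⋂ Ker L_{β±} ∩ ⋂ Ker L_{β̂±}` with `L_θ = iΩ(·, θ)` (1.11), the Definition of `W_sa`, and Thm 1.6 (i) «`W_sa` is selfadjoint by construction» (= arXiv:2112.05500 (2.11), (2.15), Thm 2.6 (i), arXiv pp. 4–7); EdmundsEvans2018, Ch. III §4 Thm 4.8 with (4.11)] -/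
theorem isSelfAdjoint_domRestrict_of_omega_annihilator (hlam : 0 < lam)
    (b : Fin 4 → L2R) (hb : ∀ k, b k ∈ (prolateMax lam).domain)
    (hiso : ∀ j k, omegaForm lam ⟨b j, hb j⟩ ⟨b k, hb k⟩ = 0)
    (hind : ∀ c : Fin 4 → ℂ, (∑ k, c k • b k) ∈ (prolateMin lam).domain → c = 0)
    {L : Submodule ℂ L2R} (hL : L ≤ (prolateMax lam).domain)
    (hmem : ∀ ξ : (prolateMax lam).domain, (ξ : L2R) ∈ L ↔ ∀ k, omegaForm lam ξ ⟨b k, hb k⟩ = 0) :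
    IsSelfAdjoint ((prolateMax lam).domRestrict L) ∧
      L = (prolateMin lam).domain ⊔ Submodule.span ℂ (Set.range b) := by
  set U : Submodule ℂ L2R := (prolateMin lam).domain ⊔ Submodule.span ℂ (Set.range b) with hU
  have hbU : ∀ k, b k ∈ U := fun k => Submodule.mem_sup_right (Submodule.subset_span ⟨k, rfl⟩)
  have hUmax : U ≤ (prolateMax lam).domain :=
    sup_le (prolateMin_le_prolateMax lam).1 (Submodule.span_le.2 (by rintro _ ⟨k, rfl⟩; exact hb k))
  have hUmem : ∀ {u : L2R}, u ∈ U →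
      ∃ m ∈ (prolateMin lam).domain, ∃ c : Fin 4 → ℂ, u = m + ∑ k, c k • b k := by
    intro u hu
    obtain ⟨m, hm, s, hs, rfl⟩ := Submodule.mem_sup.1 hu
    obtain ⟨c, rfl⟩ := (Submodule.mem_span_range_iff_exists_fun ℂ).1 hs
    exact ⟨m, hm, c, rfl⟩
  -- `Ω(η, u) = ∑ cₖ Ω(η, bₖ)` on `U`; in particular `Ω` vanishes on `U × U`
  have hΩbU : ∀ (k) (u : (prolateMax lam).domain), (u : L2R) ∈ U →
      omegaForm lam ⟨b k, hb k⟩ u = 0 := by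
    intro k u hu
    obtain ⟨m, hm, c, hue⟩ := hUmem hu
    have h := omegaForm_right_of_eq_add_sum b hb ⟨b k, hb k⟩ hm c hue u.2
    rw [h]
    exact Finset.sum_eq_zero fun j _ => by rw [hiso k j, mul_zero]
  have hΩUb : ∀ (u : (prolateMax lam).domain) (k), (u : L2R) ∈ U →
      omegaForm lam u ⟨b k, hb k⟩ = 0 := by
    intro u k hu
    rw [omegaForm_swap, hΩbU k u hu, _root_.map_zero]
  have hΩU : ∀ (x y : (prolateMax lam).domain), (x : L2R) ∈ U → (y : L2R) ∈ U →
      omegaForm lam x y = 0 := by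
    intro x y hx hy
    obtain ⟨m', hm', c', hye⟩ := hUmem hy
    have h := omegaForm_right_of_eq_add_sum b hb x hm' c' hye y.2
    rw [h]
    exact Finset.sum_eq_zero fun k _ => by rw [hΩUb x k hx, mul_zero]
  -- `S := W_max|_U` is a symmetric extension of `W_min` with four independent vectors: self-adjoint
  set S : L2R →ₗ.[ℂ] L2R := (prolateMax lam).domRestrict U with hS
  have hSdom : S.domain = U := by
    rw [hS, LinearPMap.domRestrict_domain]; exact inf_eq_left.2 hUmax
  have hSle : S ≤ prolateMax lam := LinearPMap.domRestrict_le
  have hminS : prolateMin lam ≤ S :=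
    le_of_le_of_le_of_domain_le (prolateMin_le_prolateMax lam) hSle (by rw [hSdom]; exact le_sup_left)
  have hSsym : S.IsSymmetric := by
    intro x y
    have hx : (x : L2R) ∈ U := by rw [← hSdom]; exact x.2
    have hy : (y : L2R) ∈ U := by rw [← hSdom]; exact y.2
    have ex : (S x : L2R) = prolateMax lam ⟨x, hSle.1 x.2⟩ := hSle.2 rfl
    have ey : (S y : L2R) = prolateMax lam ⟨y, hSle.1 y.2⟩ := hSle.2 rfl
    rw [ex, ey]
    exact inner_prolateMax_comm_of_omegaForm_eq_zero _ _ (hΩU ⟨x, hSle.1 x.2⟩ ⟨y, hSle.1 y.2⟩ hx hy)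
  have hbS : ∀ k, b k ∈ S.domain := fun k => by rw [hSdom]; exact hbU k
  have hSA : IsSelfAdjoint S :=
    isSelfAdjoint_of_prolateMin_le_of_independent hlam hminS hSsym b hbS hind
  -- `L = U`: `U ⊆ L` by isotropy, `L ⊆ dom S† = dom S = U` by self-adjointness
  have hLU : L = U := by
    apply le_antisymm
    · intro ξ hξ
      have hξM : ξ ∈ (prolateMax lam).domain := hL hξ
      have hk := (hmem ⟨ξ, hξM⟩).1 hξ
      have hξadj : ξ ∈ S†.domain := by
        refine LinearPMap.mem_adjoint_domain_of_exists ξ ⟨prolateMax lam ⟨ξ, hξM⟩, fun u => ?_⟩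
        have hu : (u : L2R) ∈ U := by rw [← hSdom]; exact u.2
        have eu : (S u : L2R) = prolateMax lam ⟨u, hSle.1 u.2⟩ := hSle.2 rfl
        rw [eu]
        obtain ⟨m, hm, c, hue⟩ := hUmem hu
        refine inner_prolateMax_comm_of_omegaForm_eq_zero ⟨ξ, hξM⟩ ⟨u, hSle.1 u.2⟩ ?_
        rw [omegaForm_right_of_eq_add_sum b hb ⟨ξ, hξM⟩ hm c hue]
        exact Finset.sum_eq_zero fun k _ => by rw [hk k, mul_zero]
      rw [LinearPMap.isSelfAdjoint_def.1 hSA, hSdom] at hξadj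
      exact hξadj
    · intro u hu
      exact (hmem ⟨u, hUmax hu⟩).2 fun k => hΩUb ⟨u, hUmax hu⟩ k hu
  refine ⟨?_, hLU⟩
  rw [hLU]
  exact hSA

/-- **`W_sa` is self-adjoint by construction** — in the vocabulary of `CM22_thm_1_6`: as soon as
`𝓛_β` is identified as the `Ω`-annihilator of four pairwise `Ω`-orthogonal vectors `β±, β̂± ∈ dom W_max`
independent modulo `dom W_min` ((1.15): (1.19) ⟺ `Ω(ξ, β±) = 0`, (1.20) ∧ (1.21) ⟺
`Ω(ξ, β̂±) = 0`), `prolateSA λ` IS SELF-ADJOINT and `𝓛_β = dom W_min + span{β±, β̂±}`. [cite: ConnesMoscovici2022, §1: the `ℰ`-paragraph after Lemma 1.3 («selfadjoint extensions of `W_min` are parametrized by self-orthogonal subspaces of `ℰ`»), eq. (1.15) `𝓛_β = ⋂ Ker L_{β±} ∩ ⋂ Ker L_{β̂±}` with `L_θ = iΩ(·, θ)` (1.11), the Definition of `W_sa`, and Thm 1.6 (i) «`W_sa` is selfadjoint by construction» (= arXiv:2112.05500 (2.11), (2.15), Thm 2.6 (i), arXiv pp. 4–7); EdmundsEvans2018,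 Ch. III §4 Thm 4.8 with (4.11)] -/
theorem isSelfAdjoint_prolateSA_of_omega_annihilator (hlam : 0 < lam)
    (b : Fin 4 → L2R) (hb : ∀ k, b k ∈ (prolateMax lam).domain)
    (hiso : ∀ j k, omegaForm lam ⟨b j, hb j⟩ ⟨b k, hb k⟩ = 0)
    (hind : ∀ c : Fin 4 → ℂ, (∑ k, c k • b k) ∈ (prolateMin lam).domain → c = 0)
    (hmem : ∀ ξ : (prolateMax lam).domain,
      (ξ : L2R) ∈ prolateSASet lam ↔ ∀ k, omegaForm lam ξ ⟨b k, hb k⟩ = 0) :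
    IsSelfAdjoint (prolateSA lam hlam) ∧
      prolateSADomain lam hlam = (prolateMin lam).domain ⊔ Submodule.span ℂ (Set.range b) :=
  isSelfAdjoint_domRestrict_of_omega_annihilator hlam b hb hiso hind (prolateSADomain_le hlam)
    fun ξ => by rw [mem_prolateSADomain]; exact hmem ξ

/-- … and then every `W` with `IsProlateSA λ W` is self-adjoint (first half of Thm 1.6 (i)). [cite: ConnesMoscovici2022, §1: the `ℰ`-paragraph after Lemma 1.3 («selfadjoint extensions of `W_min` are parametrized by self-orthogonal subspaces of `ℰ`»), eq. (1.15) `𝓛_β = ⋂ Ker L_{β±} ∩ ⋂ Ker L_{β̂±}` with `L_θ = iΩ(·, θ)` (1.11), the Definition of `W_sa`, and Thm 1.6 (i) «`W_sa` is selfadjoint by construction» (= arXiv:2112.05500 (2.11), (2.15), Thm 2.6 (i), arXiv pp. 4–7); EdmundsEvans2018, Ch. III §4 Thm 4.8 with (4.11)] -/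
theorem IsProlateSA.isSelfAdjoint_of_omega_annihilator (hlam : 0 < lam) {W : L2R →ₗ.[ℂ] L2R}
    (hW : IsProlateSA lam W)
    (b : Fin 4 → L2R) (hb : ∀ k, b k ∈ (prolateMax lam).domain)
    (hiso : ∀ j k, omegaForm lam ⟨b j, hb j⟩ ⟨b k, hb k⟩ = 0)
    (hind : ∀ c : Fin 4 → ℂ, (∑ k, c k • b k) ∈ (prolateMin lam).domain → c = 0)
    (hmem : ∀ ξ : (prolateMax lam).domain,
      (ξ : L2R) ∈ prolateSASet lam ↔ ∀ k, omegaForm lam ξ ⟨b k, hb k⟩ = 0) :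
    IsSelfAdjoint W := by
  rw [hW.eq_prolateSA hlam]
  exact (isSelfAdjoint_prolateSA_of_omega_annihilator hlam b hb hiso hind hmem).1

end Lagrangian

end Literature.NumberTheory.ConnesMoscovici2022
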